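import Summits.QuantumFields.BalabanUV.Beta.GAN24.InsertionChainDecayBalaban
import Summits.QuantumFields.BalabanUV.Beta.GAN24.UnitLatticeDecayAlgebra
import Summits.QuantumFields.BalabanUV.Beta.GAN24.EffectiveFormInsertionLaw

/-!
# `BalabanUV.Beta.GAN24.EffectiveFormDecay` — binder row G-an2-4 ∕ (CONV-C), routes R6 «VALUES, NOT DERIVATIVES» × R7 «TWO CURRENCIES», PART 128: THE EFFECTIVE FORM
# AND ITS u-DERIVATIVE IN BOTH CURRENCIES ON BAŁABAN's (1.18)-AVERAGED TOWER AT `U = 1` — UNCONDITIONALLY.  With `c_k = unitCovB k = (L^d)^k·Q_k𝒢^{(k)}Q_kᴴ` (Hermitian,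
# `γ_B`-coercive — `uniformCoercive_unitCovB`; entry decay at an admissible rate `κ` — PART 126), the Combes–Thomas step ON THE UNIT LATTICE (PART 127) gives the
# level- and volume-uniform entry decay of `c_k⁻¹` (= `Δ_k + a` of the [B5] (1.65) dictionary) at some `κ′ > 0`, hence of the EFFECTIVE FORM `Σ_k = c_k⁻¹ − a·1` (R6's END
# object, PART 18 ∕ 118), and — by the product rule of PART 127 with the insertion chain `ċ_k` of PART 126 — of its u-DERIVATIVE `Σ̇_k = c_k⁻¹ċ_kc_k⁻¹` (first-order model);
# joined with the operator-norm rates of NE2 (`inv_unitCovB_tendsto`) and PART 118 (`effFormInsertion_balaban`) this is King's (4.38) ∕ (CONV-C) shape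
# `‖(Σ_{k+1} − Σ_k)(x,y)‖, ‖(Σ̇_{k+1} − Σ̇_k)(x,y)‖ ≤ B·(√(L⁻¹))^k·e^{−δ·distK(x,y)}` with ONE pair `(δ, B)` for ALL tori `M` — every input a tree theorem, `d ≥ 2`, `L ≥ 2`, `a > 0`
# (unit b2b-balaban-gan24-p3, gen 52; v1)

NOT IN PRINT; OUR PROOF ([folklore] composition BY NAME: PART 126 (`hdec_unitCovB_of_wCoercive`, `hdecB_insertion_of_wCoercive`, `exists_admissible_rate` of PART 124), PART 127
(`entryDecay_inv_distK`, `entryDecay_mul_distK`, `entryDecay_one`, `entryDecay_smul`), PART 118 (`effFormInsertion_balaban`, `isUnit_det_unitCovB_and_opNorm_inv_le`), NE2's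
`BalabanAveragedCoerciveTower` (`uniformCoercive_unitCovB`, `inv_unitCovB_tendsto`), b05's `B5Prop11Plancherel.calG_isHermitian`, the NE2 swarm's Δ3-CT chain (`conjDefect_calDalev_rho`,
`wCoercive_calDa_of_conjDefect`, `hPc_firstOrder`), and the row owner's `DecayRateInterpolation.decayStations_of_rate` (the join); nothing printed is a hypothesis —
[Balaban1984PropagatorsI] (1.65) ∕ (1.69) ∕ (1.71) locate the OBJECTS (`Δ_k + a = (Q_k𝒢Q_kᴴ)⁻¹` is the cell's untyped Woodbury dictionary, not asserted), [King1986] Lemma 4.5 (4.38)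
p. 674 is the printed SHAPE of the conclusion).
HONEST FRAMING (cell contract, verbatim): «discharging `BetaPertH` makes Bałaban's UV stability UNCONDITIONAL — a real constructive-QFT result; it is NOT the
continuum limit and NOT the Clay problem.»  HONEST DEPENDENCY (verbatim): «continuum YM on T⁴ ⇐ BetaPertH ∧ nine spine estimates (0/9 proved); BetaPertH ⇐
(D1) ∧ (D4) ∧ CAP+tail; G-an2-4 gates asym, D1 and NE2/3/4.»

WHY THIS FILE.  Route R6's ENDs (PARTs 18 ∕ 20 ∕ 88–104) conclude `|𝒮_{j+1}(a,b) − 𝒮_j(a,b)| ≤ cst·θ^j` for the EFFECTIVE FORM entrywise «on a FIXED finite unit lattice; no spatial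
decay, no infinite volume» (`gen48/R6-STATE-OF-THE-ROUTE.md` §1, §4: «`LimitForm.conv` wants a rate for kernels on ℤ^d WITH DECAY — a different currency»).  PART 118 proved
that END at `U = 1` (and with perturbative background) on Bałaban's averaged tower with NO letter, still without decay.  THIS FILE adds the missing half: the effective
form's kernel on the unit torus DECAYS exponentially, uniformly in the level AND in the volume, and so does its u-derivative, and the two halves join into (CONV-C)'s
literal two-clause shape — for the Σ-type block and its first u-derivative, at `U = 1`, unconditionally.  The volume-uniformity is what makes the finite-torus statement
an honest shadow of the ℤ^d currency: ONE `(δ, B)` serves every torus `M`.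

WHAT THIS FILE PROVES (0 sorry, 0 `def`, nothing cited; `c_k = unitCovB L M a ha k`, `distK` the unit-torus sup-distance, `γ_B = gammaB d a`):
* §1 `entryDecay_of_le_rate` (rate monotonicity), `isHermitian_avgTow`, **`isHermitian_unitCovB`** (`c_k` is Hermitian: `𝒢` is, b05's `calG_isHermitian`).
* §2 **`exists_decay_inv_unitCovB`** (`L ≥ 2`, `d ≥ 2`): `∃ κ′ B′ > 0` depending on `(d, L, a)` only with `EntryDecay distK (c_k⁻¹) B′ κ′` for EVERY torus `M` and EVERY level `k` — PART 126's
  `hdec` for `c_k` at an admissible `κ` + PART 127's unit-lattice Combes–Thomas step at a `κ′ ≤ κ∕2` small enough that `(2κ′∕κ)²·B_c·dS < γ_B` (continuity at `κ′ = 0`).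
* §3 **`decayStations_inv_unitCovB`** — THE JOIN for `c_k⁻¹` (`= Δ_k + a` of the dictionary): `∃ κ′ B′ > 0 ∀ M ∃ c_∞`: `c_k → c_∞`, `EntryDecay distK c_∞⁻¹ B′ κ′`,
  `‖(c_k⁻¹ − c_∞⁻¹)(x,y)‖ ≤ √(2B′·γ_B⁻²CQB∕(1−L⁻¹))·(√(L⁻¹))^k·e^{−(κ′∕2)distK(x,y)}` and the two-level shape — NE2's `inv_unitCovB_tendsto` (rate) × §2 (decay) by `decayStations_of_rate`;
  **`twoLevelDecayRate_effForm`**: the SAME two-level clause for the effective form `Σ_k = c_k⁻¹ − a·1` (its one-step differences ARE those of `c_k⁻¹`) — R6's END SHAPE WITH DECAY, every torus.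
* §4 **`exists_decay_effIns`** (`d ≥ 2`, `L ≥ 2`, `LipschitzBackground V α β`): `∃ δ B″ > 0`, depending on `(d, L, a, α, β)` only, with `EntryDecay distK (c_k⁻¹ċ_kc_k⁻¹) B″ δ` for every `M, k`
  (`ċ_k` the (1.18)-averaged first insertion chain of PART 118 ∕ 126; two products of PART 127); **`decayStations_effIns`** — THE JOIN for `Σ̇_k`: PART 118's `effFormInsertion_balaban`
  (limit `Σ̇_∞` with rate `L^{−k}`) × §4 ⟹ `EntryDecay distK Σ̇_∞ B″ δ`, `DecayRate … (δ∕2) (√(L⁻¹))`, `TwoLevelDecayRate … (δ∕2) (√(L⁻¹))` with ONE `(δ, B)` for all tori — the u-DERIVATIVE of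
  the effective form in (CONV-C)'s two currencies, UNCONDITIONALLY.
WHAT IT DOES NOT DO: identify `c_k⁻¹ − a` with Bałaban's `Δ_k` (1.65) (the Woodbury dictionary — NE2's residual (R9.xii), not typed); the 2 × 2 table's Ξ ∕ Γ blocks (same algebra over
PARTs 105–113's objects — follower); second u-derivatives `Σ̈` (PART 121's object — the same two product steps, follower); King's tower (no UB letter there); backgrounds (PART 118's
`effForm_perturbed_balaban` has the rate; its decay needs `hdec` WITH background — PART 125 ∕ 126 give it for the chains, the perturbed `c_k(t)` needs the colour ∕ QB dictionary on
`(Δ_a + tP)⁻¹`, follower); explicit numbers for `κ′, δ`.  SUPPLIER work (junction R6 × R7 × NE2 × Δ3-CT); no consumer of record; NEVER «G-an2-4 closed»; NOT (CONV-C) (a `U = 1` ∕ first-order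
MODEL statement on finite tori), NOT D1, NOT `BetaPertH`, NOT continuum, NOT Clay.  Records: `HOME/b2b-balaban-gan24-p3/gen52/README.md`.
-/

noncomputable section

open scoped BigOperators ComplexConjugate Matrix Matrix.Norms.L2Operator
open Filter Topology

namespace Summit.QuantumFields.BalabanUV.Beta.GAN24.EffectiveFormDecay

open Literature.MathematicalPhysics.QuantumFieldTheory.Balaban1983to89.B5Prop11Plancherel (Cst Cst_nonneg Tor fine calG_isHermitian)
open Literature.MathematicalPhysics.QuantumFieldTheory.Balaban1983to89.B5G183RateUnitTower (lev)
open Summit.QuantumFields.BalabanUV.T4Continuum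
open Summit.QuantumFields.BalabanUV.T4Continuum.CoerciveInverseTower (Coercive)
open Summit.QuantumFields.BalabanUV.T4Continuum.CovariantAveragingTower (Atow avgTow)
open Summit.QuantumFields.BalabanUV.T4Continuum.BalabanAveragedTowerUnit (idx QBlev calGlev unitCovB one_le_lev')
open Summit.QuantumFields.BalabanUV.T4Continuum.BalabanAveragedCoercive (gammaB gammaB_pos)
open Summit.QuantumFields.BalabanUV.T4Continuum.BalabanAveragedCoerciveTower (uniformCoercive_unitCovB inv_unitCovB_tendsto)
open Summit.QuantumFields.BalabanUV.T4Continuum.BalabanLineAverage (CQB CQB_nonneg)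
open Summit.QuantumFields.BalabanUV.T4Continuum.KingPairingPlantedLaw (calDalev calDalev_inv CJ)
open Summit.QuantumFields.BalabanUV.T4Continuum.FirstOrderBackgroundModel (LipschitzBackground Pmodel C2model)
open Summit.QuantumFields.BalabanUV.T4Continuum.CTWeightedCoercivity (conjMat WCoercive)
open Summit.QuantumFields.BalabanUV.T4Continuum.CTKingTowerWeights (rho distK)
open Summit.QuantumFields.BalabanUV.T4Continuum.CTConjugatedHbd (G2 wCoercive_calDa_of_conjDefect)
open Summit.QuantumFields.BalabanUV.T4Continuum.CTConjDefectDischarge (conjDefect_calDalev_rho max_JA_lt_gamD)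
open Summit.QuantumFields.BalabanUV.T4Continuum.CTAdmissibleRate (exists_pos_le_one_of_eventually)
open Summit.QuantumFields.BalabanUV.T4Continuum.DirichletRegionTower (gamD gamD_pos)
open Summit.QuantumFields.BalabanUV.T4Continuum.ScalarAveragedPropagator (gammaPs)
open Summit.QuantumFields.BalabanUV.T4Continuum.ScalarAveragedCompression (sigma0)
open Summit.QuantumFields.BalabanUV.T4Continuum.CTScalarGreen (Jfree)
open Summit.QuantumFields.BalabanUV.T4Continuum.CTGaugeTerm (deltaK)
open Summit.QuantumFields.BalabanUV.T4Continuum.CTVectorPropagator (JA)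
open Summit.QuantumFields.BalabanUV.T4Continuum.DecayRateInterpolation (EntryDecay DecayRate TwoLevelDecayRate decayStations_of_rate)
open Summit.QuantumFields.BalabanUV.Beta.GAN24.InsertionChainDecay (hPc_firstOrder exists_admissible_rate insertionTower_one_eq)
open Summit.QuantumFields.BalabanUV.Beta.GAN24.InsertionChainDecayBalaban (hdec_unitCovB_of_wCoercive hdecB_insertion_of_wCoercive)
open Summit.QuantumFields.BalabanUV.Beta.GAN24.UnitLatticeDecayAlgebra (entryDecay_inv_distK entryDecay_mul_distK distK_nonneg)
open Summit.QuantumFields.BalabanUV.Beta.GAN24.EffectiveFormInsertionLaw (effFormInsertion_balaban isUnit_det_unitCovB_and_opNorm_inv_le)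

/-! ## §1 Rate monotonicity; the averaged covariance is Hermitian -/

section Generic

variable {n : Type*} [Fintype n] [DecidableEq n]

omit [Fintype n] [DecidableEq n] in
/-- entry decay at rate `δ` is entry decay at every smaller rate `δ′ ≤ δ` (`dist ≥ 0`, `B ≥ 0`). [folklore] -/
theorem entryDecay_of_le_rate {dist : n → n → ℝ} (hd0 : ∀ x y, 0 ≤ dist x y) {M : Matrix n n ℂ} {B δ δ' : ℝ} (hM : EntryDecay dist M B δ)
    (hB : 0 ≤ B) (hδ : δ' ≤ δ) : EntryDecay dist M B δ' := fun x y =>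
  (hM x y).trans (mul_le_mul_of_nonneg_left (Real.exp_le_exp.mpr (by nlinarith [hd0 x y])) hB)

variable {ι : ℕ → Type*} [∀ k, Fintype (ι k)] [∀ k, DecidableEq (ι k)]

/-- the unit-lattice image of a Hermitian level operator is Hermitian (`r` real). [folklore] -/
theorem isHermitian_avgTow (A : (k : ℕ) → Matrix (ι k) (ι (k + 1)) ℂ) (r : ℝ) {X : (k : ℕ) → Matrix (ι k) (ι k) ℂ} {k : ℕ}
    (hX : (X k).IsHermitian) : (avgTow A r X k).IsHermitian := by
  unfold avgTow
  have h1 : (Atow A k * X k * (Atow A k)ᴴ).IsHermitian := Matrix.isHermitian_mul_mul_conjTranspose _ hX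
  unfold Matrix.IsHermitian at h1 ⊢
  rw [Matrix.conjTranspose_smul, h1, star_pow, Complex.star_def, Complex.conj_ofReal]

end Generic

section Balaban

variable {d : ℕ} (L : ℕ) [NeZero L] (M : Fin d → ℕ) [hM : ∀ μ, NeZero (M μ)] (a : ℝ) (ha : 0 < a)

/-- **`c_k = unitCovB k` is Hermitian** (`𝒢^{(k)}` is: b05's `calG_isHermitian`). [folklore] -/
theorem isHermitian_unitCovB (k : ℕ) : (unitCovB L M a ha k).IsHermitian := by
  unfold unitCovB
  exact isHermitian_avgTow (QBlev L M) ((L : ℝ) ^ d) (X := calGlev L M a ha) (calG_isHermitian (lev L k) (one_le_lev' L k) M a ha)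

/-! ## §2 The inverse averaged covariance decays, uniformly in the level and in the volume -/

/-- **`exists_decay_inv_unitCovB` — THE ENTRY DECAY OF `c_k⁻¹` (`= Δ_k + a` OF THE DICTIONARY), UNCONDITIONALLY** [our proof] (`d ≥ 2`): there are `κ′ > 0` and `B′ > 0`, depending on
`(d, L, a)` only, such that `‖(unitCovB k)⁻¹(x,y)‖ ≤ B′·e^{−κ′·distK(x,y)}` for EVERY torus `M`, every level `k` and all `x, y` — PART 126's `hdec` for `c_k` at an admissible rate `κ`
(`exists_admissible_rate`, `conjDefect_calDalev_rho`), `c_k` Hermitian (§1) and `γ_B`-coercive (`uniformCoercive_unitCovB`), and PART 127's Combes–Thomas step on the unit torus at a rate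
`κ′ ≤ κ∕2` with `(κ′∕(κ∕2))²·B_c·dS < γ_B`. -/
theorem exists_decay_inv_unitCovB (hd : 2 ≤ d) :
    ∃ κ' B' : ℝ, 0 < κ' ∧ 0 < B' ∧ ∀ (M : Fin d → ℕ) [∀ μ, NeZero (M μ)] (k : ℕ), EntryDecay (distK L M) (unitCovB L M a ha k)⁻¹ B' κ' := by
  -- an admissible fine-level rate `κ` and the `hdec` constant of `c_k`
  obtain ⟨κ, hκ0, -, hγ', hδ', hJA⟩ := exists_admissible_rate d a
  have hJγ : max (JA d a 1 κ 1) 0 < gamD d a := max_JA_lt_gamD a hJA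
  set Bc : ℝ := (gamD d a - max (JA d a 1 κ 1) 0)⁻¹ * Real.exp (κ * 4) with hBc
  have hBc0 : 0 ≤ Bc := by have := sub_pos.mpr hJγ; positivity
  have hdec : ∀ (M : Fin d → ℕ) [∀ μ, NeZero (M μ)] (k : ℕ), EntryDecay (distK L M) (unitCovB L M a ha k) Bc κ := by
    intro M _ k
    have hW : ∀ (k : ℕ) (y : idx L M 0), WCoercive (calDalev L M a ha k) κ (rho L M k y) (gamD d a - max (JA d a 1 κ 1) 0) :=
      fun k y => wCoercive_calDa_of_conjDefect (lev L k) (one_le_lev' L k) M a ha (conjDefect_calDalev_rho L M a ha one_pos hγ' hδ' k y)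
    exact hdec_unitCovB_of_wCoercive L M a ha hκ0.le (sub_pos.mpr hJγ) hW k
  -- the unit-lattice Combes–Thomas step at reference rate `κ₀ = κ/2`
  have hκ2 : 0 < κ / 2 := half_pos hκ0
  obtain ⟨S, hS0, hS⟩ := entryDecay_inv_distK (d := d) hd hκ2 (half_lt_self hκ0)
  -- choose `κ′ ∈ (0, κ/2]` with `(κ′/(κ/2))²·Bc·dS < γ_B` (continuity at `κ′ = 0`)
  set T : ℝ := Bc * (d * S) with hT
  have hγB : 0 < gammaB d a := gammaB_pos a ha
  have hev : ∀ᶠ κ' : ℝ in 𝓝 0, (κ' / (κ / 2)) ^ 2 * T < gammaB d a ∧ κ' ≤ κ / 2 := by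
    refine Filter.Eventually.and ?_ (eventually_le_nhds hκ2)
    have hcont : Continuous fun κ' : ℝ => (κ' / (κ / 2)) ^ 2 * T := by fun_prop
    have h0 : (fun κ' : ℝ => (κ' / (κ / 2)) ^ 2 * T) 0 < gammaB d a := by simp [hγB]
    exact hcont.continuousAt.eventually_lt continuousAt_const h0
  obtain ⟨κ', hκ'0, -, hlt, hle⟩ := exists_pos_le_one_of_eventually hev
  refine ⟨κ', (gammaB d a - (κ' / (κ / 2)) ^ 2 * (Bc * (d * S)))⁻¹, hκ'0, inv_pos.mpr (sub_pos.mpr hlt), fun M _ k => ?_⟩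
  exact hS L M (unitCovB L M a ha k) (gammaB d a) Bc κ' (isHermitian_unitCovB L M a ha k) (uniformCoercive_unitCovB L M a ha k) (hdec M k)
    hκ'0.le hle hlt

/-! ## §3 The join for `c_k⁻¹` and the effective form `Σ_k = c_k⁻¹ − a·1` -/

/-- **`decayStations_inv_unitCovB` — `(Q_k𝒢Q_kᴴ)⁻¹` IN BOTH CURRENCIES, UNCONDITIONALLY** [our proof] (`L ≥ 2`, `d ≥ 2`): there are `κ′ > 0`, `B′ > 0` depending on `(d, L, a)` only such that for
EVERY torus `M` the inverses `c_k⁻¹` converge to `c_∞⁻¹` (`c_∞` the limit of the averaged covariances), `EntryDecay distK c_∞⁻¹ B′ κ′`, and King's shapes hold: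
`‖(c_k⁻¹ − c_∞⁻¹)(x,y)‖ ≤ √(2B′·(γ_B⁻²CQB)∕(1−L⁻¹))·(√(L⁻¹))^k·e^{−(κ′∕2)·distK(x,y)}`, `‖(c_{k+1}⁻¹ − c_k⁻¹)(x,y)‖ ≤ √(2B′·2(γ_B⁻²CQB)∕(1−L⁻¹))·(√(L⁻¹))^k·e^{−(κ′∕2)·distK(x,y)}` — the rate is NE2's
`inv_unitCovB_tendsto`, the decay §2, the join `decayStations_of_rate`. [cite: Balaban1984PropagatorsI, (1.65) p.29, (1.71) p.30 (objects); King1986, Lemma 4.5 (4.38) p.674 (shape)] -/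
theorem decayStations_inv_unitCovB (hL : 2 ≤ L) (hd : 2 ≤ d) :
    ∃ κ' B' : ℝ, 0 < κ' ∧ 0 < B' ∧ ∀ (M : Fin d → ℕ) [∀ μ, NeZero (M μ)], ∃ cinf : Matrix (idx L M 0) (idx L M 0) ℂ,
      Tendsto (unitCovB L M a ha) atTop (𝓝 cinf) ∧
      EntryDecay (distK L M) cinf⁻¹ B' κ' ∧
      DecayRate (distK L M) (fun k => (unitCovB L M a ha k)⁻¹) cinf⁻¹
        (Real.sqrt (2 * B' * (((gammaB d a)⁻¹) ^ 2 * CQB d a / (1 - (L : ℝ)⁻¹)))) (κ' / 2) (Real.sqrt ((L : ℝ)⁻¹)) ∧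
      TwoLevelDecayRate (distK L M) (fun k => (unitCovB L M a ha k)⁻¹)
        (Real.sqrt (2 * B' * (2 * (((gammaB d a)⁻¹) ^ 2 * CQB d a) / (1 - (L : ℝ)⁻¹)))) (κ' / 2) (Real.sqrt ((L : ℝ)⁻¹)) := by
  obtain ⟨κ', B', hκ', hB', hdec⟩ := exists_decay_inv_unitCovB L a ha hd
  refine ⟨κ', B', hκ', hB', fun M _ => ?_⟩
  have hL1 : (1 : ℝ) < L := by exact_mod_cast (lt_of_lt_of_le one_lt_two hL : 1 < L)
  have hρ0 : (0 : ℝ) ≤ (L : ℝ)⁻¹ := inv_nonneg.mpr (Nat.cast_nonneg _)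
  have hρ1 : ((L : ℝ)⁻¹) < 1 := inv_lt_one_of_one_lt₀ hL1
  obtain ⟨cinf, hlim, -, hinvlim, hrate⟩ := inv_unitCovB_tendsto L M a ha hL
  have hrate' : ∀ k, ‖(unitCovB L M a ha k)⁻¹ - cinf⁻¹‖ ≤ ((gammaB d a)⁻¹) ^ 2 * CQB d a * ((L : ℝ)⁻¹) ^ k / (1 - (L : ℝ)⁻¹) := fun k =>
    (hrate k).trans (le_of_eq (by ring))
  obtain ⟨h1, h2, h3⟩ := decayStations_of_rate hρ0 hρ1 hinvlim hrate' (fun k => hdec M k)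
  exact ⟨cinf, hlim, h1, h2, h3⟩

/-- **`twoLevelDecayRate_effForm` — R6's END SHAPE WITH DECAY FOR THE EFFECTIVE FORM `Σ_k = c_k⁻¹ − a·1`, EVERY TORUS, UNCONDITIONALLY** [our proof] (`L ≥ 2`, `d ≥ 2`): ONE pair
`(κ′, B)` depending on `(d, L, a)` only with `‖(Σ_{k+1} − Σ_k)(x,y)‖ ≤ B·(√(L⁻¹))^k·e^{−(κ′∕2)·distK(x,y)}` for all `M, k, x, y` (the regulator cancels in the differences). -/
theorem twoLevelDecayRate_effForm (hL : 2 ≤ L) (hd : 2 ≤ d) :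
    ∃ κ' B : ℝ, 0 < κ' ∧ ∀ (M : Fin d → ℕ) [∀ μ, NeZero (M μ)],
      TwoLevelDecayRate (distK L M) (fun k => (unitCovB L M a ha k)⁻¹ - (a : ℂ) • (1 : Matrix (idx L M 0) (idx L M 0) ℂ)) B (κ' / 2)
        (Real.sqrt ((L : ℝ)⁻¹)) := by
  obtain ⟨κ', B', hκ', -, h⟩ := decayStations_inv_unitCovB L a ha hL hd
  refine ⟨κ', Real.sqrt (2 * B' * (2 * (((gammaB d a)⁻¹) ^ 2 * CQB d a) / (1 - (L : ℝ)⁻¹))), hκ', fun M _ => ?_⟩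
  obtain ⟨cinf, -, -, -, h2⟩ := h M
  intro k x y
  have e : ((unitCovB L M a ha (k + 1))⁻¹ - (a : ℂ) • (1 : Matrix (idx L M 0) (idx L M 0) ℂ))
      - ((unitCovB L M a ha k)⁻¹ - (a : ℂ) • (1 : Matrix (idx L M 0) (idx L M 0) ℂ))
      = (unitCovB L M a ha (k + 1))⁻¹ - (unitCovB L M a ha k)⁻¹ := by abel
  rw [e]
  exact h2 k x y

/-! ## §4 The u-derivative of the effective form `Σ̇_k = c_k⁻¹ċ_kc_k⁻¹` (first-order model) in both currencies -/

/-- **`exists_decay_effIns` — THE ENTRY DECAY OF `Σ̇_k = c_k⁻¹ċ_kc_k⁻¹`, UNCONDITIONALLY** [our proof] (`d ≥ 2`): for `LipschitzBackground V α β`, `ċ_k` the (1.18)-averaged first insertion chain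
`(L^d)^k·Q_k𝒢^{(k)}(V^{(k)}·∇^{(k)})𝒢^{(k)}Q_kᴴ`, there are `δ > 0`, `B″ ≥ 0` depending on `(d, L, a, α, β)` only with `EntryDecay distK (c_k⁻¹ċ_kc_k⁻¹) B″ δ` for every torus `M` and level `k` —
§2 for `c_k⁻¹`, PART 126's `hdec` for `ċ_k`, two product steps of PART 127 (rates `min ↦ ∕2 ↦ ∕4`). -/
theorem exists_decay_effIns (hd : 2 ≤ d) {α β : ℝ} (hαβ : 0 ≤ α ∧ 0 ≤ β) :
    ∃ δ B'' : ℝ, 0 < δ ∧ 0 ≤ B'' ∧ ∀ (M : Fin d → ℕ) [∀ μ, NeZero (M μ)] (V : (k : ℕ) → Fin d → (idx L M k → ℂ))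
      (_hV : LipschitzBackground L M V α β) (k : ℕ),
      EntryDecay (distK L M) ((unitCovB L M a ha k)⁻¹
        * avgTow (QBlev L M) ((L : ℝ) ^ d) (fun k => calGlev L M a ha k * Pmodel L M V k * calGlev L M a ha k) k
        * (unitCovB L M a ha k)⁻¹) B'' δ := by
  -- `c_k⁻¹` at `(B′, κ′)`
  obtain ⟨κ', B', hκ', hB', hinv⟩ := exists_decay_inv_unitCovB L a ha hd
  -- `ċ_k` at an admissible rate `κ` with constant `Bdot`
  obtain ⟨κ, hκ0, -, hγ', hδ', hJA⟩ := exists_admissible_rate d a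
  have hJ0 : 0 ≤ max (JA d a 1 κ 1) 0 := le_max_right _ _
  have hJγ : max (JA d a 1 κ 1) 0 < gamD d a := max_JA_lt_gamD a hJA
  set Bdot : ℝ := (gamD d a - max (JA d a 1 κ 1) 0)⁻¹
    * (d * (α * G2 d a (max (JA d a 1 κ 1) 0) (gamD d a - max (JA d a 1 κ 1) 0) κ)) ^ 1 * Real.exp (κ * 4) with hBdot
  have hBdot0 : 0 ≤ Bdot := by
    have := sub_pos.mpr hJγ
    have := CTConjugatedHbd.G2_nonneg (d := d) a (max (JA d a 1 κ 1) 0) this κ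
    have := hαβ.1
    positivity
  -- the common rate `δ₀ = min κ′ κ`, then two product steps
  set δ₀ : ℝ := min κ' κ with hδ₀
  have hδ₀0 : 0 < δ₀ := lt_min hκ' hκ0
  obtain ⟨S₁, hS₁, hmul₁⟩ := entryDecay_mul_distK (d := d) hd hδ₀0
  obtain ⟨S₂, hS₂, hmul₂⟩ := entryDecay_mul_distK (d := d) hd (half_pos hδ₀0)
  refine ⟨δ₀ / 2 / 2, B' * Bdot * (d * S₁) * B' * (d * S₂), by positivity, by positivity, fun M _ V hV k => ?_⟩
  have hW : ∀ (k : ℕ) (y : idx L M 0), WCoercive (calDalev L M a ha k) κ (rho L M k y) (gamD d a - max (JA d a 1 κ 1) 0) :=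
    fun k y => wCoercive_calDa_of_conjDefect (lev L k) (one_le_lev' L k) M a ha (conjDefect_calDalev_rho L M a ha one_pos hγ' hδ' k y)
  have hPc : ∀ (k : ℕ) (y : idx L M 0),
      ‖conjMat κ (rho L M k y) (rho L M k y) (Pmodel L M V k) * conjMat κ (rho L M k y) (rho L M k y) (calDalev L M a ha k)⁻¹‖
        ≤ d * (α * G2 d a (max (JA d a 1 κ 1) 0) (gamD d a - max (JA d a 1 κ 1) 0) κ) :=
    fun k y => hPc_firstOrder L M a ha hV hJ0 hJγ k y (conjDefect_calDalev_rho L M a ha one_pos hγ' hδ' k y)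
  have hdot := hdecB_insertion_of_wCoercive L M a ha hκ0.le (sub_pos.mpr hJγ) hW hPc 1 k
  rw [insertionTower_one_eq L M a ha V] at hdot
  -- common rate
  have h1 : EntryDecay (distK L M) (unitCovB L M a ha k)⁻¹ B' δ₀ := entryDecay_of_le_rate (distK_nonneg L M) (hinv M k) hB'.le (min_le_left _ _)
  have h2 : EntryDecay (distK L M)
      (avgTow (QBlev L M) ((L : ℝ) ^ d) (fun k => calGlev L M a ha k * Pmodel L M V k * calGlev L M a ha k) k) Bdot δ₀ :=
    entryDecay_of_le_rate (distK_nonneg L M) hdot hBdot0 (min_le_right _ _)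
  have h12 := hmul₁ L M _ _ B' Bdot h1 h2
  have h1' : EntryDecay (distK L M) (unitCovB L M a ha k)⁻¹ B' (δ₀ / 2) :=
    entryDecay_of_le_rate (distK_nonneg L M) h1 hB'.le (half_le_self hδ₀0.le)
  exact hmul₂ L M _ _ _ B' h12 h1'

/-- **`decayStations_effIns` — THE u-DERIVATIVE OF THE EFFECTIVE FORM IN BOTH CURRENCIES, UNCONDITIONALLY** [our proof] (`L ≥ 2`, `2 ≤ d`; `LipschitzBackground V α β`): there is ONE pair
`(δ, B)` depending on `(d, L, a, α, β)` only such that for EVERY torus `M` the tower `Σ̇_k = c_k⁻¹ċ_kc_k⁻¹` converges to a limit `Σ̇_∞` (PART 118) with `EntryDecay distK Σ̇_∞ B″ δ` and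
`‖(Σ̇_k − Σ̇_∞)(x,y)‖ ≤ B·(√(L⁻¹))^k·e^{−(δ∕2)·distK(x,y)}`, `‖(Σ̇_{k+1} − Σ̇_k)(x,y)‖ ≤ B·(√(L⁻¹))^k·e^{−(δ∕2)·distK(x,y)}` — (CONV-C)'s literal two-clause shape for the first u-derivative of
the Σ-block at `U = 1` on Bałaban's averaged tower, every input a tree theorem. [cite: King1986, Lemma 4.5 (4.38) p.674 (shape)] -/
theorem decayStations_effIns (hL : 2 ≤ L) (hd : 2 ≤ d) {α β : ℝ} (hαβ : 0 ≤ α ∧ 0 ≤ β) :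
    ∃ δ B'' B : ℝ, 0 < δ ∧ ∀ (M : Fin d → ℕ) [∀ μ, NeZero (M μ)] (V : (k : ℕ) → Fin d → (idx L M k → ℂ))
      (_hV : LipschitzBackground L M V α β), ∃ Ilim : Matrix (idx L M 0) (idx L M 0) ℂ,
      Tendsto (fun k => (unitCovB L M a ha k)⁻¹
          * avgTow (QBlev L M) ((L : ℝ) ^ d) (fun k => calGlev L M a ha k * Pmodel L M V k * calGlev L M a ha k) k
          * (unitCovB L M a ha k)⁻¹) atTop (𝓝 Ilim) ∧
      EntryDecay (distK L M) Ilim B'' δ ∧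
      DecayRate (distK L M) (fun k => (unitCovB L M a ha k)⁻¹
          * avgTow (QBlev L M) ((L : ℝ) ^ d) (fun k => calGlev L M a ha k * Pmodel L M V k * calGlev L M a ha k) k
          * (unitCovB L M a ha k)⁻¹) Ilim B (δ / 2) (Real.sqrt ((L : ℝ)⁻¹)) ∧
      TwoLevelDecayRate (distK L M) (fun k => (unitCovB L M a ha k)⁻¹
          * avgTow (QBlev L M) ((L : ℝ) ^ d) (fun k => calGlev L M a ha k * Pmodel L M V k * calGlev L M a ha k) k
          * (unitCovB L M a ha k)⁻¹) B (δ / 2) (Real.sqrt ((L : ℝ)⁻¹)) := by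
  obtain ⟨δ, B'', hδ, hB'', hdec⟩ := exists_decay_effIns L a ha hd hαβ
  have hd1 : 1 ≤ d := le_trans one_le_two hd
  -- PART 118's rate constant (depends on `(d, L, a, α, β)` only)
  set C : ℝ := ((gammaB d a)⁻¹) ^ 2 * ((2 * (d * (α + β) * Cst d a) * CJ d a + C2model d L a α β)
        + (d * (α + β) * Cst d a) * (2 * d * Cst d a + 2 * (d * L * Cst d a)))
      + 2 * ((gammaB d a)⁻¹) ^ 3 * ((d * (α + β) * Cst d a) * Cst d a) * CQB d a with hC
  refine ⟨δ, B'', max (Real.sqrt (2 * B'' * (C / (1 - (L : ℝ)⁻¹)))) (Real.sqrt (2 * B'' * (2 * C / (1 - (L : ℝ)⁻¹)))), hδ,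
    fun M _ V hV => ?_⟩
  have hL1 : (1 : ℝ) < L := by exact_mod_cast (lt_of_lt_of_le one_lt_two hL : 1 < L)
  have hρ0 : (0 : ℝ) ≤ (L : ℝ)⁻¹ := inv_nonneg.mpr (Nat.cast_nonneg _)
  have hρ1 : ((L : ℝ)⁻¹) < 1 := inv_lt_one_of_one_lt₀ hL1
  obtain ⟨Ilim, hlim, hrate⟩ := effFormInsertion_balaban L M a ha hL hd1 hV
  obtain ⟨h1, h2, h3⟩ := decayStations_of_rate hρ0 hρ1 hlim hrate (fun k => hdec M V hV k)
  refine ⟨Ilim, hlim, h1, fun k x y => (h2 k x y).trans ?_, fun k x y => (h3 k x y).trans ?_⟩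
  · exact mul_le_mul_of_nonneg_right (mul_le_mul_of_nonneg_right (le_max_left _ _) (pow_nonneg (Real.sqrt_nonneg _) k)) (Real.exp_pos _).le
  · exact mul_le_mul_of_nonneg_right (mul_le_mul_of_nonneg_right (le_max_right _ _) (pow_nonneg (Real.sqrt_nonneg _) k)) (Real.exp_pos _).le

end Balaban

end Summit.QuantumFields.BalabanUV.Beta.GAN24.EffectiveFormDecay

end
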